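import Literature.Topology.FourManifolds.HurwitzDeletionCriterion
import HarnessLib

/-!
# Hurwitz–deletion nullity depends only on the mapping classes of the letters

Topic `Literature/Topology/FourManifolds`; companion of `HurwitzDeletionCalculus.lean` and
`HurwitzDeletionCriterion.lean`.  Theorems only.

A letter `(c, ε) : Letter P o` carries honest DATA (an oriented annulus chart `c : TwistCurve P o`),
and the Hurwitz moves of `DehnTwistFactorisation.lean` act on that data (`Letter.act`,
`TwistCurve.mapRel`).  This file proves that the null calculus nevertheless only sees MAPPING
CLASSES: if two words are letterwise *class-equal* — same signs and same classes
`t_c^{ε} = t_{c'}^{ε}` in `Mod(P, ∂P)` (equivalently, letterwise isotopic curves with equal signs) —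
then one is Hurwitz-null iff the other is (`IsHurwitzNull.of_classEq`, `isHurwitzNull_iff_of_classEq`).
So the apex `stub_hurwitzNullConnectedBinding` of the line `hurwitz-deletion-presentation` (crux
`ConvexBisection.AcyclicBisectionRigidity`, stmt-SmoothPoincare4-10507) is a statement about signed
words in `Mod(P, ∂P)`, independent of the chosen annulus charts — the form in which it is computed
(`Mod(S_{g,1}) ↪ Aut F_{2g}`).  Proof: a simulation — every null step from `w` is matched, up to
class-equality, by a null step from any class-equal `w'` (a reverse Hurwitz move is matched by a
FORWARD move of the other chirality, a reverse conjugation by the conjugation by `g⁻¹`, so no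
equality of chart data is ever needed).

## References

* D. Auroux, *A stable classification of Lefschetz fibrations*, Geom. Topol. 9 (2005), §2. [Auroux2005]
* B. Farb, D. Margalit, *A Primer on Mapping Class Groups* (2012), Fact 3.7. [FarbMargalit2012]
-/

open scoped Manifold ContDiff Topology
open Set Function

noncomputable section

namespace Literature.Topology.FourManifolds

section ClassInvariance

variable {P : Type*} [TopologicalSpace P] [T2Space P] [ChartedSpace (EuclideanHalfSpace 2) P]
  [IsManifold (𝓡∂ 2) ∞ P] {o : SmoothOrientation (𝓡∂ 2) P}

/-! ### Class-equality of letters and words -/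

/-- Two letters with the same sign and the same class have twisting data with the same twist.
[cite: FarbMargalit2012, Fact 3.7] -/
theorem twist_eq_of_toClass_eq {x y : Letter P o} (hs : x.2 = y.2) (hc : x.toClass = y.toClass) :
    x.1.twist = y.1.twist := by
  obtain ⟨c, ε⟩ := x
  obtain ⟨d, η⟩ := y
  simp only at hs
  subst hs
  cases ε
  · simpa [Letter.toClass_false] using hc
  · simpa [Letter.toClass_true] using hc

/-- Moving class-equal data by class-equal letters gives class-equal letters:
`t_{x·d}^{η} = t_x^{ε} t_d^{η} t_x^{-ε}` depends only on classes. [cite: Auroux2005, §2] -/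
theorem toClass_act_congr {x x' y y' : Letter P o} (hx : x.toClass = x'.toClass)
    (hy : y.toClass = y'.toClass) :
    Letter.toClass (x.act y.1, y.2) = Letter.toClass (x'.act y'.1, y'.2) := by
  rw [Letter.toClass_act, Letter.toClass_act, hx, hy]

/-- Splitting a `Forall₂` along an append on the left. [folklore] -/
theorem forall₂_append_left_split {α β : Type*} {R : α → β → Prop} {l₁ l₂ : List α} {l : List β}
    (h : List.Forall₂ R (l₁ ++ l₂) l) :
    ∃ m₁ m₂, List.Forall₂ R l₁ m₁ ∧ List.Forall₂ R l₂ m₂ ∧ l = m₁ ++ m₂ := by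
  induction l₁ generalizing l with
  | nil => exact ⟨[], l, List.Forall₂.nil, h, rfl⟩
  | cons a l₁ ih =>
    obtain ⟨b, l', hab, h', rfl⟩ := List.forall₂_cons_left_iff.1 h
    obtain ⟨m₁, m₂, h₁, h₂, rfl⟩ := ih h'
    exact ⟨b :: m₁, m₂, List.Forall₂.cons hab h₁, h₂, rfl⟩

/-! ### The simulation -/

/-- **One null step is simulated along class-equality.**  If `w` and `w'` are letterwise
class-equal (same signs, same classes) and `w ↝ w₁` is a null step, then some null step `w' ↝ w₁'`
lands on a word class-equal to `w₁`. [cite: Auroux2005, §2] -/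
theorem NullStep.exists_classEq {w w₁ w' : List (Letter P o)} (h : NullStep w w₁)
    (hR : List.Forall₂ (fun x y => x.2 = y.2 ∧ x.toClass = y.toClass) w w') :
    ∃ w₁', NullStep w' w₁' ∧ List.Forall₂ (fun x y => x.2 = y.2 ∧ x.toClass = y.toClass) w₁ w₁' := by
  rcases h with hm | hm | hd
  · -- forward move
    cases hm with
    | hurwitz hs =>
      obtain ⟨pre, suf, x, y, rfl, hw₁⟩ := hs
      obtain ⟨pre', rest, hpre, hrest, rfl⟩ := forall₂_append_left_split hR
      obtain ⟨x', rest', ⟨hxs, hxc⟩, hrest', rfl⟩ := List.forall₂_cons_left_iff.1 hrest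
      obtain ⟨y', suf', ⟨hys, hyc⟩, hsuf, rfl⟩ := List.forall₂_cons_left_iff.1 hrest'
      rcases hw₁ with rfl | rfl
      · refine ⟨pre' ++ (x'.act y'.1, y'.2) :: x' :: suf', Or.inl (Move.hurwitz ⟨pre', suf', x', y', rfl,
          Or.inl rfl⟩), ?_⟩
        refine List.rel_append hpre (List.Forall₂.cons ⟨hys, ?_⟩ (List.Forall₂.cons ⟨hxs, hxc⟩ hsuf))
        exact toClass_act_congr hxc hyc
      · refine ⟨pre' ++ y' :: (y'.inv.act x'.1, x'.2) :: suf', Or.inl (Move.hurwitz ⟨pre', suf', x', y',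
          rfl, Or.inr rfl⟩), ?_⟩
        refine List.rel_append hpre (List.Forall₂.cons ⟨hys, hyc⟩ (List.Forall₂.cons ⟨hxs, ?_⟩ hsuf))
        exact toClass_act_congr (by rw [Letter.toClass_inv, Letter.toClass_inv, hyc]) hxc
    | conj g hg w =>
      refine ⟨conjWord g hg w', Or.inl (Move.conj g hg w'), ?_⟩
      simp only [conjWord]
      refine List.forall₂_map_left_iff.2 (List.forall₂_map_right_iff.2 ?_)
      exact List.Forall₂.imp
        (fun x y h => ⟨h.1, by rw [Letter.toClass_mapRel, Letter.toClass_mapRel, h.2]⟩) hR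
  · -- reverse move `Move w₁ w`
    cases hm with
    | hurwitz hs =>
      obtain ⟨pre, suf, x, y, rfl, hw⟩ := hs
      rcases hw with rfl | rfl
      · -- w = pre ++ (x.act y.1, y.2) :: x :: suf ; match by the FORWARD move of the other chirality
        obtain ⟨pre', rest, hpre, hrest, rfl⟩ := forall₂_append_left_split hR
        obtain ⟨z', rest', ⟨hzs, hzc⟩, hrest', rfl⟩ := List.forall₂_cons_left_iff.1 hrest
        obtain ⟨x', suf', ⟨hxs, hxc⟩, hsuf, rfl⟩ := List.forall₂_cons_left_iff.1 hrest'
        refine ⟨pre' ++ x' :: (x'.inv.act z'.1, z'.2) :: suf',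
          Or.inl (Move.hurwitz ⟨pre', suf', z', x', rfl, Or.inr rfl⟩), ?_⟩
        refine List.rel_append hpre (List.Forall₂.cons ⟨hxs, hxc⟩ (List.Forall₂.cons ⟨hzs, ?_⟩ hsuf))
        -- y.toClass = x'⁻¹ z' x'
        rw [Letter.toClass_act, Letter.toClass_inv, ← hxc, ← hzc, Letter.toClass_act]
        have : Letter.toClass (y.1, y.2) = y.toClass := rfl
        group
      · -- w = pre ++ y :: (y.inv.act x.1, x.2) :: suf
        obtain ⟨pre', rest, hpre, hrest, rfl⟩ := forall₂_append_left_split hR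
        obtain ⟨y', rest', ⟨hys, hyc⟩, hrest', rfl⟩ := List.forall₂_cons_left_iff.1 hrest
        obtain ⟨z', suf', ⟨hzs, hzc⟩, hsuf, rfl⟩ := List.forall₂_cons_left_iff.1 hrest'
        refine ⟨pre' ++ (y'.act z'.1, z'.2) :: y' :: suf',
          Or.inl (Move.hurwitz ⟨pre', suf', y', z', rfl, Or.inl rfl⟩), ?_⟩
        refine List.rel_append hpre (List.Forall₂.cons ⟨hzs, ?_⟩ (List.Forall₂.cons ⟨hys, hyc⟩ hsuf))
        rw [Letter.toClass_act, ← hyc, ← hzc, Letter.toClass_act, Letter.toClass_inv]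
        have : Letter.toClass (x.1, x.2) = x.toClass := rfl
        group
    | conj g hg w₁ =>
      -- w = conjWord g w₁ ; match by the conjugation of w' by g⁻¹
      have hg' : g⁻¹ ∈ RelDiffeo.orientedSubgroup ((𝓡∂ 2).boundary P) o := inv_mem hg
      refine ⟨conjWord g⁻¹ hg' w', Or.inl (Move.conj g⁻¹ hg' w'), ?_⟩
      have hR' : List.Forall₂ (fun x y => x.2 = y.2 ∧ Letter.toClass (x.1.mapRel g hg, x.2) = y.toClass)
          w₁ w' := by
        have := List.forall₂_map_left_iff.1 (show List.Forall₂
          (fun x y => x.2 = y.2 ∧ x.toClass = y.toClass) (conjWord g hg w₁) w' from hR)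
        exact this
      simp only [conjWord]
      refine List.forall₂_map_right_iff.2 (List.Forall₂.imp (fun x y h => ⟨h.1, ?_⟩) hR')
      have hc := h.2
      rw [Letter.toClass_mapRel] at hc
      rw [Letter.toClass_mapRel, ← hc, map_inv]
      group
  · -- deletion
    obtain ⟨pre, suf, c, d, ε, rfl, hcd, rfl⟩ := hd
    obtain ⟨pre', rest, hpre, hrest, rfl⟩ := forall₂_append_left_split hR
    obtain ⟨x', rest', ⟨hxs, hxc⟩, hrest', rfl⟩ := List.forall₂_cons_left_iff.1 hrest
    obtain ⟨y', suf', ⟨hys, hyc⟩, hsuf, rfl⟩ := List.forall₂_cons_left_iff.1 hrest'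
    have hx' : x' = (x'.1, ε) := by ext <;> simp [← hxs]
    have hy' : y' = (y'.1, !ε) := by ext <;> simp [← hys]
    refine ⟨pre' ++ suf', Or.inr (Or.inr ⟨pre', suf', x'.1, y'.1, ε, by rw [← hx', ← hy'], ?_, rfl⟩),
      List.rel_append hpre hsuf⟩
    have h1 : c.twist = x'.1.twist :=
      twist_eq_of_toClass_eq (x := (c, ε)) (y := x') hxs hxc
    have h2 : d.twist = y'.1.twist :=
      twist_eq_of_toClass_eq (x := (d, !ε)) (y := y') hys hyc
    rw [← h1, ← h2, hcd]

/-- **Nullity is invariant under letterwise class-equality.** [cite: Auroux2005, §2] -/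
theorem IsHurwitzNull.of_classEq {w w' : List (Letter P o)} (h : IsHurwitzNull w)
    (hR : List.Forall₂ (fun x y => x.2 = y.2 ∧ x.toClass = y.toClass) w w') : IsHurwitzNull w' := by
  unfold IsHurwitzNull at h ⊢
  induction h using Relation.ReflTransGen.head_induction_on generalizing w' with
  | refl =>
    rw [List.forall₂_nil_left_iff.1 hR]
  | head hst _ ih =>
    obtain ⟨w₁', hst', hR'⟩ := hst.exists_classEq hR
    exact Relation.ReflTransGen.head hst' (ih hR')

/-- Class-equality is symmetric. [folklore] -/
theorem classEq_symm {w w' : List (Letter P o)}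
    (hR : List.Forall₂ (fun x y => x.2 = y.2 ∧ x.toClass = y.toClass) w w') :
    List.Forall₂ (fun x y => x.2 = y.2 ∧ x.toClass = y.toClass) w' w :=
  List.Forall₂.flip (List.Forall₂.imp (fun _ _ h => ⟨h.1.symm, h.2.symm⟩) hR)

/-- **The null calculus sees only mapping classes**: letterwise class-equal words (same signs, same
classes `t_c^{ε}` in `Mod(P, ∂P)`) are null together.  In particular `IsHurwitzNull` does not depend
on the annulus charts chosen for the vanishing cycles, only on their isotopy classes and signs.
[cite: Auroux2005, §2] -/
theorem isHurwitzNull_iff_of_classEq {w w' : List (Letter P o)}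
    (hR : List.Forall₂ (fun x y => x.2 = y.2 ∧ x.toClass = y.toClass) w w') :
    IsHurwitzNull w ↔ IsHurwitzNull w' :=
  ⟨fun h => h.of_classEq hR, fun h => h.of_classEq (classEq_symm hR)⟩

end ClassInvariance

end Literature.Topology.FourManifolds

end
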